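import Summits.NavierStokesRegularity.NavierStokesRegularity.Theorems.PoloidalWindowRigidity.Negative.ExpTriadLinearFlow
import HarnessLib

/-!
# Strained crossed suction layers — an exact UNSTEADY poloidal Navier–Stokes flow whose
# proportional-shear slope `Λ(t) = α²/(α² + σ²)` is spatially constant but varies in time
# (the (TV) witness against the space–time form of LRC″; crux `PoloidalWindowRigidity`, K2, 19708)

Theorems/…/Negative proofs file (theorems only, no `Prop` facts).  Part 3 of 4: the instance.

With `α(t) = e^{t}`, `σ(t) = s e^{−2t}`, `G(t) = exp(α²/2 − σ²/4 − t)/(α² + σ²)` and the axisymmetric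
strain `M = diag(−1, −1, 2)`, the field
`u(t,x) = M x + G(t)·[a(−σ,0,α) e^{αx₀+σx₂} + b(σ,0,α) e^{−αx₀+σx₂} + c(0,σ,α) e^{αx₁−σx₂}]`
is, for ALL real `s, a, b, c`, an exact classical Navier–Stokes flow on `ℝ × ℝ³` (viscosity `1`, zero
force): `isClassicalNSSolutionOn_strainedField`.  The three modes are real exponential Craik–Criminale
waves advected by the strain (`k̇ = −Mᵀk`), their amplitude ODE is solved by the common factor `G`, and
the three pairwise interactions are pressure gradients (pair coefficients `2abG²α²`, `−acG²σ²`, `−bcG²σ²`)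
— the hypotheses of `ExpTriad.isClassicalNSSolutionOn_triad` (parts 1–2).  Part 4 reads off the slices:
poloidal vorticity, slope `Λ(t) = α²/(α²+σ²)` with `dΛ/dt ≠ 0`, no Killing symmetry.

Spatially unbounded (linear strain + exponential layers): NOT in the route's class `𝔓(C)`; it refutes
no registered item — it shows that the purely local space–time LRC″ (hypothesis shape of `stub_lrc`)
cannot be proved without the class hypotheses.  WHAT THIS IS NOT: not a statement about Navier–Stokes
regularity or blow-up.  Mechanism references: Craik–Criminale 1986 (doi:10.1098/rspa.1986.0068);
asymptotic suction layer [cite: book-drazin2002-introduction-hydrodynamic-stability, Ex. 8.27 p. 151];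
Burgers-type strained layers (folklore).
-/

noncomputable section

open Set Function Filter InnerProductSpace WithLp
open scoped ContDiff InnerProductSpace RealInnerProductSpace InnerProduct Topology

-- the summit and its single sub-problem share the name (CONVENTIONS §1)
set_option linter.dupNamespace false

/-! ## Instance on `ℝ³`: three strained crossed suction layers (the (TV) witness) -/

namespace Summit.NavierStokesRegularity.NavierStokesRegularity.Theorems.PoloidalWindowRigidity.Negative.StrainedLayers

open Real Literature.Analysis.FluidPDE Literature.Analysis.FluidPDE.KelvinMode
open Summit.NavierStokesRegularity.NavierStokesRegularity.Theorems.PoloidalWindowRigidity.Negative.ExpTriad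

/-- Local notation for physical space `ℝ³ = EuclideanSpace ℝ (Fin 3)`. -/
local notation "ℝ³" => EuclideanSpace ℝ (Fin 3)
/-- Local notation for the standard basis vectors. -/
local notation "𝐞" j => EuclideanSpace.single (j : Fin 3) (1 : ℝ)

/-! ### §1 The time-dependent scalars `α(t) = e^t`, `σ(t) = s e^{−2t}`, `G(t)` -/

/-- Horizontal wavenumber `α(t) = e^{t}` (grows under the axial compression rate `−1`). [folklore] -/
def α (t : ℝ) : ℝ := exp t

/-- Vertical wavenumber `σ(t) = s e^{−2t}` (decays under the axial stretching rate `2`). [folklore] -/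
def σ (s t : ℝ) : ℝ := s * exp (-2 * t)

/-- The common amplitude factor `G(t) = exp(α²/2 − σ²/4 − t) / (α² + σ²)` solving
`Ġ/G = (α² + σ²) − 1 − (2α² − 4σ²)/(α² + σ²)`. [folklore] -/
def G (s t : ℝ) : ℝ := exp (α t ^ 2 / 2 - σ s t ^ 2 / 4 - t) / (α t ^ 2 + σ s t ^ 2)

/-- `α > 0`. [folklore] -/
theorem α_pos (t : ℝ) : 0 < α t := exp_pos t

/-- `α ≠ 0`. [folklore] -/
theorem α_ne_zero (t : ℝ) : α t ≠ 0 := (α_pos t).ne'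

/-- `σ ≠ 0` for `s ≠ 0`. [folklore] -/
theorem σ_ne_zero {s : ℝ} (hs : s ≠ 0) (t : ℝ) : σ s t ≠ 0 := mul_ne_zero hs (exp_pos _).ne'

/-- `α² + σ² > 0`. [folklore] -/
theorem normSq_pos (s t : ℝ) : 0 < α t ^ 2 + σ s t ^ 2 :=
  add_pos_of_pos_of_nonneg (pow_pos (α_pos t) 2) (sq_nonneg _)

/-- `G > 0`. [folklore] -/
theorem G_pos (s t : ℝ) : 0 < G s t := div_pos (exp_pos _) (normSq_pos s t)

/-- `α̇ = α`. [folklore] -/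
theorem hasDerivAt_α (t : ℝ) : HasDerivAt α (α t) t := Real.hasDerivAt_exp t

/-- `σ̇ = −2σ`. [folklore] -/
theorem hasDerivAt_σ (s t : ℝ) : HasDerivAt (σ s) (-2 * σ s t) t := by
  have h1 : HasDerivAt (fun τ : ℝ => -2 * τ) (-2) t := by
    simpa using (hasDerivAt_id t).const_mul (-2 : ℝ)
  have h3 : HasDerivAt (fun τ : ℝ => s * exp (-2 * τ)) (s * (exp (-2 * t) * -2)) t :=
    h1.exp.const_mul s
  refine h3.congr_deriv ?_
  show s * (exp (-2 * t) * -2) = -2 * (s * exp (-2 * t))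
  ring

/-- `Ġ = G · ((α² + σ²) − 1 − (2α² − 4σ²)/(α² + σ²))`. [folklore] -/
theorem hasDerivAt_G (s t : ℝ) : HasDerivAt (G s)
    (G s t * (α t ^ 2 + σ s t ^ 2 - 1 - (2 * α t ^ 2 - 4 * σ s t ^ 2) / (α t ^ 2 + σ s t ^ 2))) t := by
  have hα := hasDerivAt_α t
  have hσ := hasDerivAt_σ s t
  have hn : HasDerivAt (fun τ => α τ ^ 2 + σ s τ ^ 2) (2 * α t * α t + 2 * σ s t * (-2 * σ s t)) t := by
    have := (hα.pow 2).add (hσ.pow 2)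
    refine this.congr_deriv ?_
    simp
  have hE : HasDerivAt (fun τ => exp (α τ ^ 2 / 2 - σ s τ ^ 2 / 4 - τ))
      (exp (α t ^ 2 / 2 - σ s t ^ 2 / 4 - t) *
        (2 * α t * α t / 2 - 2 * σ s t * (-2 * σ s t) / 4 - 1)) t := by
    have := (((hα.pow 2).div_const 2).sub ((hσ.pow 2).div_const 4)).sub (hasDerivAt_id t)
    have := this.exp
    refine this.congr_deriv ?_
    simp
  have h := hE.div hn (normSq_pos s t).ne'
  refine h.congr_deriv ?_
  have hn0 : α t ^ 2 + σ s t ^ 2 ≠ 0 := (normSq_pos s t).ne'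
  simp only [G]
  field_simp
  ring

/-- `α`, `σ`, `G` are smooth. [folklore] -/
theorem contDiff_α {n : WithTop ℕ∞} : ContDiff ℝ n α := Real.contDiff_exp

/-- `σ` is smooth. [folklore] -/
theorem contDiff_σ (s : ℝ) {n : WithTop ℕ∞} : ContDiff ℝ n (σ s) :=
  contDiff_const.mul (contDiff_const.mul contDiff_id).exp

/-- `G` is smooth. [folklore] -/
theorem contDiff_G (s : ℝ) {n : WithTop ℕ∞} : ContDiff ℝ n (G s) := by
  refine ContDiff.div ?_ ((contDiff_α.pow 2).add ((contDiff_σ s).pow 2))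
    fun t => (normSq_pos s t).ne'
  exact (((contDiff_α.pow 2).div_const 2).sub (((contDiff_σ s).pow 2).div_const 4)).sub
    contDiff_id |>.exp

/-! ### §2 Vectors built from three scalar functions -/

/-- Derivative of a curve given by three coordinate functions. [folklore] -/
private theorem hasDerivAt_vec3 {f g h : ℝ → ℝ} {f' g' h' t : ℝ} (hf : HasDerivAt f f' t)
    (hg : HasDerivAt g g' t) (hh : HasDerivAt h h' t) :
    HasDerivAt (fun τ => (toLp 2 ![f τ, g τ, h τ] : ℝ³)) (toLp 2 ![f', g', h']) t := by
  have e1 : (fun τ => (toLp 2 ![f τ, g τ, h τ] : ℝ³)) =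
      fun τ => f τ • (𝐞 0) + g τ • (𝐞 1) + h τ • (𝐞 2) := by
    funext τ; ext i; fin_cases i <;> simp
  have e2 : (toLp 2 ![f', g', h'] : ℝ³) = f' • (𝐞 0) + g' • (𝐞 1) + h' • (𝐞 2) := by
    ext i; fin_cases i <;> simp
  rw [e1, e2]
  exact ((hf.smul_const _).add (hg.smul_const _)).add (hh.smul_const _)

/-- Smoothness of a curve given by three coordinate functions. [folklore] -/
private theorem contDiff_vec3 {f g h : ℝ → ℝ} {n : WithTop ℕ∞} (hf : ContDiff ℝ n f)
    (hg : ContDiff ℝ n g) (hh : ContDiff ℝ n h) :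
    ContDiff ℝ n (fun τ => (toLp 2 ![f τ, g τ, h τ] : ℝ³)) := by
  have e1 : (fun τ => (toLp 2 ![f τ, g τ, h τ] : ℝ³)) =
      fun τ => f τ • (𝐞 0) + g τ • (𝐞 1) + h τ • (𝐞 2) := by
    funext τ; ext i; fin_cases i <;> simp
  rw [e1]
  exact ((hf.smul contDiff_const).add (hg.smul contDiff_const)).add (hh.smul contDiff_const)

/-! ### §3 The strain, the wave vectors, the amplitudes, the pair coefficients -/

/-- The axisymmetric strain `M = diag(−1, −1, 2)` (axial stretching rate `2`). [folklore] -/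
def M : ℝ³ →L[ℝ] ℝ³ := linearStrainL (-1) (-1) 2

/-- Components of `M x`. [folklore] -/
@[simp] theorem M_apply_zero (x : ℝ³) : M x 0 = -x 0 := by simp [M]
/-- Components of `M x`. [folklore] -/
@[simp] theorem M_apply_one (x : ℝ³) : M x 1 = -x 1 := by simp [M]
/-- Components of `M x`. [folklore] -/
@[simp] theorem M_apply_two (x : ℝ³) : M x 2 = 2 * x 2 := by simp [M]

/-- `M` is self-adjoint. [folklore] -/
theorem adjoint_M : M† = M := adjoint_linearStrainL (-1) (-1) 2

/-- `div (M·) = 0`. [folklore] -/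
theorem isDivFree_M : VectorCalculus.IsDivFree (fun y : ℝ³ => M y) := by
  intro x
  have h : (fun y : ℝ³ => M y) = linearStrain (-1) (-1) 2 := rfl
  rw [h, divergence_linearStrain]; ring

/-- `M²` is symmetric. [folklore] -/
theorem M_sq_symm (x y : ℝ³) : ⟪M (M x), y⟫ = ⟪x, M (M y)⟫ := linearStrainL_sq_symm (-1) (-1) 2 x y

/-- The three wave vectors `k₁ = (α, 0, σ)`, `k₂ = (−α, 0, σ)`, `k₃ = (0, α, −σ)` (solving `k̇ = −Mᵀk`). [folklore] -/
def kv (s : ℝ) : Fin 3 → ℝ → ℝ³ :=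
  ![fun t => toLp 2 ![α t, 0, σ s t], fun t => toLp 2 ![-α t, 0, σ s t],
    fun t => toLp 2 ![0, α t, -σ s t]]

/-- The three amplitudes `a G (−σ, 0, α)`, `b G (σ, 0, α)`, `c G (0, σ, α)` (each `⊥` its wave vector,
horizontal part `∥` the horizontal wave vector). [folklore] -/
def av (s a b c : ℝ) : Fin 3 → ℝ → ℝ³ :=
  ![fun t => toLp 2 ![-(a * G s t * σ s t), 0, a * G s t * α t],
    fun t => toLp 2 ![b * G s t * σ s t, 0, b * G s t * α t],
    fun t => toLp 2 ![0, c * G s t * σ s t, c * G s t * α t]]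

/-- The pair coefficients `c₀₁ = 2abG²α²`, `c₀₂ = −acG²σ²`, `c₁₂ = −bcG²σ²` (others unused). [folklore] -/
def cv (s a b c : ℝ) : Fin 3 → Fin 3 → ℝ → ℝ :=
  ![![fun _ => 0, fun t => 2 * a * b * G s t ^ 2 * α t ^ 2, fun t => -(a * c * G s t ^ 2 * σ s t ^ 2)],
    ![fun _ => 0, fun _ => 0, fun t => -(b * c * G s t ^ 2 * σ s t ^ 2)],
    ![fun _ => 0, fun _ => 0, fun _ => 0]]

/-- Unfolding `k₁`. [folklore] -/
@[simp] theorem kv_zero (s t : ℝ) : kv s 0 t = toLp 2 ![α t, 0, σ s t] := rfl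
/-- Unfolding `k₂`. [folklore] -/
@[simp] theorem kv_one (s t : ℝ) : kv s 1 t = toLp 2 ![-α t, 0, σ s t] := rfl
/-- Unfolding `k₃`. [folklore] -/
@[simp] theorem kv_two (s t : ℝ) : kv s 2 t = toLp 2 ![0, α t, -σ s t] := rfl
/-- Unfolding `a₁`. [folklore] -/
@[simp] theorem av_zero (s a b c t : ℝ) :
    av s a b c 0 t = toLp 2 ![-(a * G s t * σ s t), 0, a * G s t * α t] := rfl
/-- Unfolding `a₂`. [folklore] -/
@[simp] theorem av_one (s a b c t : ℝ) :
    av s a b c 1 t = toLp 2 ![b * G s t * σ s t, 0, b * G s t * α t] := rfl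
/-- Unfolding `a₃`. [folklore] -/
@[simp] theorem av_two (s a b c t : ℝ) :
    av s a b c 2 t = toLp 2 ![0, c * G s t * σ s t, c * G s t * α t] := rfl
/-- Unfolding `c₀₁`. [folklore] -/
@[simp] theorem cv_zero_one (s a b c t : ℝ) : cv s a b c 0 1 t = 2 * a * b * G s t ^ 2 * α t ^ 2 := rfl
/-- Unfolding `c₀₂`. [folklore] -/
@[simp] theorem cv_zero_two (s a b c t : ℝ) : cv s a b c 0 2 t = -(a * c * G s t ^ 2 * σ s t ^ 2) := rfl
/-- Unfolding `c₁₂`. [folklore] -/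
@[simp] theorem cv_one_two (s a b c t : ℝ) : cv s a b c 1 2 t = -(b * c * G s t ^ 2 * σ s t ^ 2) := rfl

/-- **The strained crossed suction layers**: `u(t, x) = M x + Σ_j e^{⟪k_j(t), x⟫} a_j(t)`. [folklore] -/
def strainedField (s a b c : ℝ) : ℝ → ℝ³ → ℝ³ := triad M (kv s) (av s a b c)

/-- Their pressure. [folklore] -/
def strainedPressure (s a b c : ℝ) : ℝ → ℝ³ → ℝ := triadPressure M (kv s) (av s a b c) (cv s a b c)

variable (s a b c : ℝ)

/-! ### §4 The hypotheses of `isClassicalNSSolutionOn_triad` -/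

/-- `‖k_j‖² = α² + σ²` for all three wave vectors. [folklore] -/
theorem norm_sq_kv (j : Fin 3) (t : ℝ) : ‖kv s j t‖ ^ 2 = α t ^ 2 + σ s t ^ 2 := by
  rw [EuclideanSpace.norm_sq_eq]
  fin_cases j <;> simp [Fin.sum_univ_three]

/-- The wave vectors never vanish. [folklore] -/
theorem kv_ne_zero (j : Fin 3) (t : ℝ) : kv s j t ≠ 0 := by
  intro h
  have h2 : ‖kv s j t‖ ^ 2 = 0 := by rw [h, norm_zero]; ring
  rw [norm_sq_kv] at h2
  exact (normSq_pos s t).ne' h2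

/-- Transversality `k_j ⊥ a_j`. [folklore] -/
theorem inner_kv_av (j : Fin 3) (t : ℝ) : ⟪kv s j t, av s a b c j t⟫ = 0 := by
  fin_cases j <;> simp [PiLp.inner_apply, Fin.sum_univ_three] <;> ring

/-- **`k̇_j = −M† k_j`.** [folklore] -/
theorem hasDerivAt_kv (j : Fin 3) (t : ℝ) : HasDerivAt (kv s j) (-((M†) (kv s j t))) t := by
  rw [adjoint_M]
  have hα := hasDerivAt_α t
  have hσ := hasDerivAt_σ s t
  have h0 := hasDerivAt_const t (0 : ℝ)
  fin_cases j
  · refine (hasDerivAt_vec3 hα h0 hσ).congr_deriv ?_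
    ext i; fin_cases i <;> simp
  · refine (hasDerivAt_vec3 hα.neg h0 hσ).congr_deriv ?_
    ext i; fin_cases i <;> simp
  · refine (hasDerivAt_vec3 h0 hα hσ.neg).congr_deriv ?_
    ext i; fin_cases i <;> simp

/-- **The amplitude equation `ȧ_j = −M a_j + (2⟪k_j, M a_j⟫/‖k_j‖²) k_j + ‖k_j‖² a_j`** (viscosity `1`). [folklore] -/
theorem hasDerivAt_av (j : Fin 3) (t : ℝ) :
    HasDerivAt (av s a b c j) (expAmplitudeRHS 1 M (kv s j t) (av s a b c j t)) t := by
  have hα := hasDerivAt_α t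
  have hσ := hasDerivAt_σ s t
  have hG := hasDerivAt_G s t
  have h0 := hasDerivAt_const t (0 : ℝ)
  have hn0 : α t ^ 2 + σ s t ^ 2 ≠ 0 := (normSq_pos s t).ne'
  have hnorm := norm_sq_kv s j t
  fin_cases j
  · have h := hasDerivAt_vec3 (((hG.const_mul a).mul hσ).neg) h0 ((hG.const_mul a).mul hα)
    refine h.congr_deriv ?_
    rw [expAmplitudeRHS, hnorm]
    ext i; fin_cases i <;> simp [PiLp.inner_apply, Fin.sum_univ_three] <;> field_simp <;> ring
  · have h := hasDerivAt_vec3 ((hG.const_mul b).mul hσ) h0 ((hG.const_mul b).mul hα)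
    refine h.congr_deriv ?_
    rw [expAmplitudeRHS, hnorm]
    ext i; fin_cases i <;> simp [PiLp.inner_apply, Fin.sum_univ_three] <;> field_simp <;> ring
  · have h := hasDerivAt_vec3 h0 ((hG.const_mul c).mul hσ) ((hG.const_mul c).mul hα)
    refine h.congr_deriv ?_
    rw [expAmplitudeRHS, hnorm]
    ext i; fin_cases i <;> simp [PiLp.inner_apply, Fin.sum_univ_three] <;> field_simp <;> ring

/-- **Pair condition (0,1)**: `⟪k₂, a₁⟫ a₂ + ⟪k₁, a₂⟫ a₁ = 2abG²α² (k₁ + k₂)`. [folklore] -/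
theorem pair_zero_one (t : ℝ) :
    ⟪kv s 1 t, av s a b c 0 t⟫ • av s a b c 1 t + ⟪kv s 0 t, av s a b c 1 t⟫ • av s a b c 0 t =
      cv s a b c 0 1 t • (kv s 0 t + kv s 1 t) := by
  ext i; fin_cases i <;> simp [PiLp.inner_apply, Fin.sum_univ_three] <;> ring

/-- **Pair condition (0,2)**: `⟪k₃, a₁⟫ a₃ + ⟪k₁, a₃⟫ a₁ = −acG²σ² (k₁ + k₃)`. [folklore] -/
theorem pair_zero_two (t : ℝ) :
    ⟪kv s 2 t, av s a b c 0 t⟫ • av s a b c 2 t + ⟪kv s 0 t, av s a b c 2 t⟫ • av s a b c 0 t =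
      cv s a b c 0 2 t • (kv s 0 t + kv s 2 t) := by
  ext i; fin_cases i <;> simp [PiLp.inner_apply, Fin.sum_univ_three] <;> ring

/-- **Pair condition (1,2)**: `⟪k₃, a₂⟫ a₃ + ⟪k₂, a₃⟫ a₂ = −bcG²σ² (k₂ + k₃)`. [folklore] -/
theorem pair_one_two (t : ℝ) :
    ⟪kv s 2 t, av s a b c 1 t⟫ • av s a b c 2 t + ⟪kv s 1 t, av s a b c 2 t⟫ • av s a b c 1 t =
      cv s a b c 1 2 t • (kv s 1 t + kv s 2 t) := by
  ext i; fin_cases i <;> simp [PiLp.inner_apply, Fin.sum_univ_three] <;> ring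

/-- The wave vectors are smooth in time. [folklore] -/
theorem contDiff_kv (j : Fin 3) : ContDiff ℝ ∞ (kv s j) := by
  fin_cases j
  · exact contDiff_vec3 contDiff_α contDiff_const (contDiff_σ s)
  · exact contDiff_vec3 contDiff_α.neg contDiff_const (contDiff_σ s)
  · exact contDiff_vec3 contDiff_const contDiff_α (contDiff_σ s).neg

/-- The amplitudes are smooth in time. [folklore] -/
theorem contDiff_av (j : Fin 3) : ContDiff ℝ ∞ (av s a b c j) := by
  have hG := contDiff_G s (n := ∞)
  fin_cases j
  · exact contDiff_vec3 ((contDiff_const.mul hG).mul (contDiff_σ s)).neg contDiff_const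
      ((contDiff_const.mul hG).mul contDiff_α)
  · exact contDiff_vec3 ((contDiff_const.mul hG).mul (contDiff_σ s)) contDiff_const
      ((contDiff_const.mul hG).mul contDiff_α)
  · exact contDiff_vec3 contDiff_const ((contDiff_const.mul hG).mul (contDiff_σ s))
      ((contDiff_const.mul hG).mul contDiff_α)

/-- The pair coefficients are smooth in time. [folklore] -/
theorem contDiff_cv (i j : Fin 3) : ContDiff ℝ ∞ (cv s a b c i j) := by
  have hG := contDiff_G s (n := ∞)
  have h01 : ContDiff ℝ ∞ (cv s a b c 0 1) := (contDiff_const.mul (hG.pow 2)).mul (contDiff_α.pow 2)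
  have h02 : ContDiff ℝ ∞ (cv s a b c 0 2) :=
    ((contDiff_const.mul (hG.pow 2)).mul ((contDiff_σ s).pow 2)).neg
  have h12 : ContDiff ℝ ∞ (cv s a b c 1 2) :=
    ((contDiff_const.mul (hG.pow 2)).mul ((contDiff_σ s).pow 2)).neg
  have hz : ContDiff ℝ ∞ (fun _ : ℝ => (0 : ℝ)) := contDiff_const
  fin_cases i <;> fin_cases j
  exacts [hz, h01, h02, hz, hz, h12, hz, hz, hz]

/-! ### §5 The exact solution -/

/-- **The strained crossed suction layers are an exact classical Navier–Stokes flow on `ℝ × ℝ³`**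
(viscosity `1`, zero force), for ALL parameters `s, a, b, c`:
`u(t,x) = (−x₀, −x₁, 2x₂) + G(t)[a(−σ,0,α)e^{αx₀+σx₂} + b(σ,0,α)e^{−αx₀+σx₂} + c(0,σ,α)e^{αx₁−σx₂}]`,
`α = e^t`, `σ = s e^{−2t}`.  Spatially unbounded; not in the route's class. [folklore] -/
theorem isClassicalNSSolutionOn_strainedField :
    IsClassicalNSSolutionOn univ 1 0 (strainedField s a b c) (strainedPressure s a b c) :=
  isClassicalNSSolutionOn_triad uniqueDiffOn_univ isDivFree_M M_sq_symm
    (fun j => (contDiff_kv s j).contDiffOn) (fun j => (contDiff_av s a b c j).contDiffOn)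
    (fun i j => (contDiff_cv s a b c i j).contDiffOn)
    (fun j t _ => (hasDerivAt_kv s j t).hasDerivWithinAt)
    (fun j t _ => (hasDerivAt_av s a b c j t).hasDerivWithinAt)
    (fun j t _ => inner_kv_av s a b c j t) (fun j t _ => kv_ne_zero s j t)
    (fun t _ => pair_zero_one s a b c t) (fun t _ => pair_zero_two s a b c t)
    (fun t _ => pair_one_two s a b c t)

end Summit.NavierStokesRegularity.NavierStokesRegularity.Theorems.PoloidalWindowRigidity.Negative.StrainedLayers
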